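import Summits.Ventures.HSemireg.WedgeHankelRecurrenceGaussFavard

/-!
# Venture HSemireg — **SECOND-KIND (NUMERATOR) POLYNOMIALS AND THE GAUSS WEIGHTS AS RESIDUES**: with `r_0 = 0`, `r_1 = 1`, `r_{n+2} = (X − a_{n+1}) r_{n+1} − b_{n+1} r_n` (the same
# recurrence as `q`), the CASORATIAN identity `q_n r_{n+1} − q_{n+1} r_n = b_1 ⋯ b_n` holds; at a zero `z` of `q_{m+1}` therefore `q_m(z) r_{m+1}(z) = b_1 ⋯ b_m`, and the Favard ∕ Gauss
# weight at `z` is `μ = (b_1 ⋯ b_m)/(q_{m+1}′(z) q_m(z)) = r_{m+1}(z)/q_{m+1}′(z)` — the residue of the Padé approximant `r_{m+1}/q_{m+1}` (explicit-weight form of the finite Favard theorem)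

HONEST FRAMING. Part of the Lean index of the computation cell `pub-hsemireg` (seat p10 gen 42, Sunday typer «UNIFORM-IN-n»).  Real polynomials and finite sums only, on top of N274 ∕ N279 ∕
N280; no variety, no cohomology theory, no sheaf, no Ext group and no semiregularity map is constructed here; nothing here says that HC / HC_CM / HC_AV holds; no Literature fact (unproved
`Prop`) is declared or used.  Custodian versions as in `WedgeHankelSiegelIdeal` (1/3).
SOURCES (cited).  T. S. Chihara, *An Introduction to Orthogonal Polynomials* (1978), Ch. III §4 (numerator polynomials, (4.3)–(4.4): the Wronskian-type identity
`P_n P^{(1)}_{n−2}… `) and Ch. I Thm 6.2 ∕ (6.5) (Gauss quadrature weights); G. Szegő, *Orthogonal Polynomials*, Thm 3.4.2 (3.4.7) (`λ_ν` in terms of `p_n′(x_ν) p_{n−1}(x_ν)`) and §3.5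
(numerators of the continued fraction); N. I. Akhiezer, *The Classical Moment Problem* (1965), Ch. I §2 (polynomials of the second kind, Liouville–Ostrogradskii formula (2.9)); this
lineage's `StieltjesFraction` ∕ `PartialFractions` modules (continued-fraction side).
PROOF TYPED HERE.  Casoratian by induction (`W_{n+1} = b_{n+1} W_n`); Christoffel–Darboux (confluent, N274) at a zero `z` of `q_{m+1}` gives `Σ_j c_j q_j(z)² = q_{m+1}′(z) q_m(z)`, which is
the normaliser `K` of N280's dual orthogonality; the Casoratian converts `(b_1⋯b_m)/(q_{m+1}′ q_m)` into `r_{m+1}/q_{m+1}′`.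
DEDUP DISCLOSURE (`rg -n 'casoratian|Casorati|secondKind|numerator polynomial' Summits/Ventures/HSemireg`, 2026-09-02): nothing for the three-term recurrence.  The 6 names below: 0 hits
tree-wide.

WHAT IS IN THE TREE.  N274 `recurrence_christoffel_darboux_confluent`; N279 `recurrence_zeros`, `recurrence_monic_natDegree`; N280 `recurrence_dual_orthogonality`, `recurrence_cd_diag_pos`,
`prod_Ico_one_div_prod_Ico_succ`.
THIS FILE (namespace `Summit.Ventures.HSemireg.Wedge.HankelOuter` continued; CHAINED on N280; 0 definitions):
* §1046 **`recurrence_casoratian`** (`q_n r_{n+1} − q_{n+1} r_n = ∏_{1 ≤ j ≤ n} b_j`), `recurrence_secondKind_eval_at_zero` (`q_m(z) r_{m+1}(z) = b_1⋯b_m` at a zero of `q_{m+1}`),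
  `recurrence_no_common_zero_secondKind` (`q_{m+1}(z) = 0 ⇒ r_{m+1}(z) ≠ 0`), `recurrence_cd_diag_eq_derivative_mul` (`K(z) = q_{m+1}′(z) q_m(z)` at a zero), **`favard_finite_explicit`**
  (THE FINITE FAVARD THEOREM WITH EXPLICIT WEIGHTS `μ_k = (b_1⋯b_m)/(q_{m+1}′(z_k) q_m(z_k))`), **`favard_weight_eq_secondKind_div_derivative`** (`μ_k = r_{m+1}(z_k)/q_{m+1}′(z_k)`).
CAVEATS.  Nothing Ext-side.  New names only.
-/

open Module Polynomial
open scoped Matrix Polynomial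

namespace Summit.Ventures.HSemireg.Wedge.HankelOuter

/-! ## §1046. Second-kind polynomials -/

/-- **THE CASORATIAN (Liouville–Ostrogradskii) IDENTITY**: if `q` and `r` satisfy the same recurrence `u_{n+2} = (X − a_{n+1}) u_{n+1} − b_{n+1} u_n` with `q_0 = 1`, `q_1 = X − a_0`,
`r_0 = 0`, `r_1 = 1`, then `q_n r_{n+1} − q_{n+1} r_n = ∏_{1 ≤ j ≤ n} b_j` (as constants). [Akhiezer I §2 (2.9); Chihara III §4; this file, §1046] -/
theorem recurrence_casoratian {q r : ℕ → ℝ[X]} {a b : ℕ → ℝ} (hq0 : q 0 = 1)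
    (hrec : ∀ n, q (n + 2) = (Polynomial.X - C (a (n + 1))) * q (n + 1) - C (b (n + 1)) * q n) (hr0 : r 0 = 0) (hr1 : r 1 = 1)
    (hrrec : ∀ n, r (n + 2) = (Polynomial.X - C (a (n + 1))) * r (n + 1) - C (b (n + 1)) * r n) (n : ℕ) :
    q n * r (n + 1) - q (n + 1) * r n = C (∏ j ∈ Finset.Ico 1 (n + 1), b j) := by
  induction n with
  | zero => rw [hq0, hr1, hr0, zero_add, Finset.Ico_self, Finset.prod_empty, C_1, mul_zero, sub_zero, one_mul]
  | succ n ih =>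
    rw [show n + 1 + 1 = n + 2 by ring, hrec n, hrrec n, Finset.prod_Ico_succ_top (by omega : 1 ≤ n + 1), C_mul, ← ih]
    ring

/-- **At a zero `z` of `q_{m+1}`: `q_m(z) r_{m+1}(z) = b_1 ⋯ b_m`.** [Chihara III §4; this file, §1046] -/
theorem recurrence_secondKind_eval_at_zero {q r : ℕ → ℝ[X]} {a b : ℕ → ℝ} (hq0 : q 0 = 1)
    (hrec : ∀ n, q (n + 2) = (Polynomial.X - C (a (n + 1))) * q (n + 1) - C (b (n + 1)) * q n) (hr0 : r 0 = 0) (hr1 : r 1 = 1)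
    (hrrec : ∀ n, r (n + 2) = (Polynomial.X - C (a (n + 1))) * r (n + 1) - C (b (n + 1)) * r n) (m : ℕ) {z : ℝ} (hz : (q (m + 1)).eval z = 0) :
    (q m).eval z * (r (m + 1)).eval z = ∏ j ∈ Finset.Ico 1 (m + 1), b j := by
  have h := congrArg (fun P => P.eval z) (recurrence_casoratian hq0 hrec hr0 hr1 hrrec m)
  simp only [eval_sub, eval_mul, eval_C, hz, zero_mul, sub_zero] at h
  exact h

/-- **No common zero of `q_{m+1}` and `r_{m+1}`** (positive `b`): `q_{m+1}(z) = 0 ⇒ r_{m+1}(z) ≠ 0`. [Chihara III §4; this file, §1046] -/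
theorem recurrence_no_common_zero_secondKind {q r : ℕ → ℝ[X]} {a b : ℕ → ℝ} (hq0 : q 0 = 1)
    (hrec : ∀ n, q (n + 2) = (Polynomial.X - C (a (n + 1))) * q (n + 1) - C (b (n + 1)) * q n) (hr0 : r 0 = 0) (hr1 : r 1 = 1)
    (hrrec : ∀ n, r (n + 2) = (Polynomial.X - C (a (n + 1))) * r (n + 1) - C (b (n + 1)) * r n) (hb : ∀ j, 0 < b j) (m : ℕ) {z : ℝ} (hz : (q (m + 1)).eval z = 0) :
    (r (m + 1)).eval z ≠ 0 := fun h0 => by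
  have h := recurrence_secondKind_eval_at_zero hq0 hrec hr0 hr1 hrrec m hz
  rw [h0, mul_zero] at h
  exact (Finset.prod_pos fun j _ => hb j).ne' h.symm

/-- **The normaliser at a zero is `q_{m+1}′(z) q_m(z)`**: `Σ_{j ≤ m} (b_{j+1} ⋯ b_m) q_j(z)² = q_{m+1}′(z) q_m(z)` when `q_{m+1}(z) = 0`. [Szegő (3.2.4); this file, §1046] -/
theorem recurrence_cd_diag_eq_derivative_mul {q : ℕ → ℝ[X]} {a b : ℕ → ℝ} (hq0 : q 0 = 1) (hq1 : q 1 = Polynomial.X - C (a 0))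
    (hrec : ∀ n, q (n + 2) = (Polynomial.X - C (a (n + 1))) * q (n + 1) - C (b (n + 1)) * q n) (m : ℕ) {z : ℝ} (hz : (q (m + 1)).eval z = 0) :
    ∑ j ∈ Finset.range (m + 1), (∏ l ∈ Finset.Ico (j + 1) (m + 1), b l) * ((q j).eval z * (q j).eval z) = (derivative (q (m + 1))).eval z * (q m).eval z := by
  have h := recurrence_christoffel_darboux_confluent hq0 hq1 hrec m z
  rw [hz, mul_zero, sub_zero] at h
  rw [← h]
  exact Finset.sum_congr rfl fun j _ => by rw [pow_two]

/-- **THE FINITE FAVARD THEOREM WITH EXPLICIT WEIGHTS**: for a positive three-term recurrence and `m ∈ ℕ`, the zeros `z_0 < ⋯ < z_m` of `q_{m+1}` with the weights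
`μ_k = (b_1 ⋯ b_m)/(q_{m+1}′(z_k) q_m(z_k))` form a positive `(m+1)`-atomic measure of total mass `1` with `Σ_k μ_k q_i(z_k) q_j(z_k) = δ_{ij} b_1 ⋯ b_j` for `i, j ≤ m`.
[Favard 1935; Chihara I Thm 4.4, Thm 6.2; Szegő (3.4.7); this file, §1046] -/
theorem favard_finite_explicit {q : ℕ → ℝ[X]} {a b : ℕ → ℝ} (hq0 : q 0 = 1) (hq1 : q 1 = Polynomial.X - C (a 0))
    (hrec : ∀ n, q (n + 2) = (Polynomial.X - C (a (n + 1))) * q (n + 1) - C (b (n + 1)) * q n) (hb : ∀ j, 0 < b j) (m : ℕ) :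
    ∃ z : Fin (m + 1) → ℝ, StrictMono z ∧ (∀ k, (q (m + 1)).eval (z k) = 0) ∧
      (∀ k, 0 < (∏ l ∈ Finset.Ico 1 (m + 1), b l) / ((derivative (q (m + 1))).eval (z k) * (q m).eval (z k))) ∧
      ∑ k, (∏ l ∈ Finset.Ico 1 (m + 1), b l) / ((derivative (q (m + 1))).eval (z k) * (q m).eval (z k)) = 1 ∧
      ∀ i j : Fin (m + 1), ∑ k, (∏ l ∈ Finset.Ico 1 (m + 1), b l) / ((derivative (q (m + 1))).eval (z k) * (q m).eval (z k)) * ((q i).eval (z k) * (q j).eval (z k))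
        = if i = j then ∏ l ∈ Finset.Ico 1 ((j : ℕ) + 1), b l else 0 := by
  obtain ⟨z, hz, hzr, -⟩ := recurrence_zeros hq0 hq1 hrec hb m
  have hK : ∀ k, ∑ j' ∈ Finset.range (m + 1), (∏ l ∈ Finset.Ico (j' + 1) (m + 1), b l) * ((q j').eval (z k) * (q j').eval (z k))
      = (derivative (q (m + 1))).eval (z k) * (q m).eval (z k) := fun k => recurrence_cd_diag_eq_derivative_mul hq0 hq1 hrec m (hzr k)
  have hKpos : ∀ k, 0 < (derivative (q (m + 1))).eval (z k) * (q m).eval (z k) := fun k => by rw [← hK k]; exact recurrence_cd_diag_pos hq0 hb m (z k)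
  have hc0pos : 0 < ∏ l ∈ Finset.Ico 1 (m + 1), b l := Finset.prod_pos fun l _ => hb l
  have hdual := fun i j => recurrence_dual_orthogonality hq0 hq1 hrec hb hz.injective hzr i j
  refine ⟨z, hz, hzr, fun k => div_pos hc0pos (hKpos k), ?_, fun i j => ?_⟩
  · have h := hdual 0 0
    rw [if_pos rfl] at h
    rw [← h]
    refine Finset.sum_congr rfl fun k _ => ?_
    have e0 : (q ((0 : Fin (m + 1)) : ℕ)).eval (z k) = 1 := by rw [Fin.val_zero, hq0, eval_one]
    rw [e0, one_mul, mul_one, Fin.val_zero, zero_add, hK k]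
  · have h := hdual i j
    have hcj : ∏ l ∈ Finset.Ico 1 (m + 1), b l = (∏ l ∈ Finset.Ico 1 ((j : ℕ) + 1), b l) * ∏ l ∈ Finset.Ico ((j : ℕ) + 1) (m + 1), b l :=
      prod_Ico_one_div_prod_Ico_succ b (Nat.lt_succ_iff.1 j.2)
    have e : ∑ k, (∏ l ∈ Finset.Ico 1 (m + 1), b l) / ((derivative (q (m + 1))).eval (z k) * (q m).eval (z k)) * ((q i).eval (z k) * (q j).eval (z k))
        = (∏ l ∈ Finset.Ico 1 ((j : ℕ) + 1), b l) * ∑ k, (q i).eval (z k) * ((∏ l ∈ Finset.Ico ((j : ℕ) + 1) (m + 1), b l) * (q j).eval (z k)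
          / ∑ j' ∈ Finset.range (m + 1), (∏ l ∈ Finset.Ico (j' + 1) (m + 1), b l) * ((q j').eval (z k) * (q j').eval (z k))) := by
      rw [Finset.mul_sum]
      refine Finset.sum_congr rfl fun k _ => ?_
      rw [hK k, hcj]
      ring
    rw [e, h]
    split_ifs <;> simp

/-- **THE GAUSS WEIGHT AS A RESIDUE**: with the second-kind polynomials `r`, at every zero `z_k` of `q_{m+1}` the Favard weight equals `r_{m+1}(z_k)/q_{m+1}′(z_k)` — the residue of
`r_{m+1}/q_{m+1}` at `z_k`. [Chihara I Thm 6.2; Akhiezer I §2; this file, §1046] -/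
theorem favard_weight_eq_secondKind_div_derivative {q r : ℕ → ℝ[X]} {a b : ℕ → ℝ} (hq0 : q 0 = 1)
    (hrec : ∀ n, q (n + 2) = (Polynomial.X - C (a (n + 1))) * q (n + 1) - C (b (n + 1)) * q n) (hr0 : r 0 = 0) (hr1 : r 1 = 1)
    (hrrec : ∀ n, r (n + 2) = (Polynomial.X - C (a (n + 1))) * r (n + 1) - C (b (n + 1)) * r n) (hb : ∀ j, 0 < b j) (m : ℕ) {z : ℝ} (hz : (q (m + 1)).eval z = 0) :
    (∏ l ∈ Finset.Ico 1 (m + 1), b l) / ((derivative (q (m + 1))).eval z * (q m).eval z) = (r (m + 1)).eval z / (derivative (q (m + 1))).eval z := by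
  have hcas := recurrence_secondKind_eval_at_zero hq0 hrec hr0 hr1 hrrec m hz
  have hqm : (q m).eval z ≠ 0 := fun h0 => by
    rw [h0, zero_mul] at hcas
    exact (Finset.prod_pos fun j _ => hb j).ne' hcas.symm
  rw [← hcas]
  field_simp

end Summit.Ventures.HSemireg.Wedge.HankelOuter
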